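import Summits.HodgeConjecture.HodgeConjecture.Theorems.VHCAbelianSchemesRoadOneNonJumpingPointOfInputsPlusPairwise
import HarnessLib

/-!
# Road №4 (`VHCAbelianSchemesRoad`), crux stmt-HodgeConjecture-26512 `DiagLocalOfMarkmanPinnedForall` — route «2T»: SOCKET v2 (#4),
# the Φ-STEP of sockets #2 ∕ #3 applied AT `𝓔 := q^*𝓓.E` ITSELF — no upstairs model, no chain-level comparison

research route conditional on HC_CM; not a corollary; Q11.4-sentence-2 already refuted in dim ≥ 3.

Seat core-w5 g9 (claim-free; `--supports stmt-HodgeConjecture-26512 --as helper`; 0 new facts; director-hodge g20 R19.108 (1) «A1 RULING: SOCKET v2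
ADOPTED for architecture (K)», LEAD 168 draft l.6478). Sockets #2 (`…OneNonJumpingPointOfInputsPlus.lean`) and #3 (`…PlusPairwise.lean`) take as DATA a
bounded vector-bundle complex `𝓔` on `P`, a rank-one `L`, an even `a`, a CHAIN-LEVEL quasi-isomorphism `f : q^*E• ⟶ (L^{⊗a})^∨ ⊗ 𝓔` and `p ∈ P[2]`, and use
`𝓔`, `L`, `a`, `f` only in the TWIST-STEP that moves non-jumping from `𝓔` to `q^*E•`. Under architecture (K) («descend the kernel») the comparison
`q^*E ≅ Φ̃(F) ⊗ D′_s` is an isomorphism IN `D⁺` (`Literature/AlgebraicGeometry/AbelianVarieties/MarkmanKernelTransformDescent`), so the Φ-STEP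
(`not_mem_extJumpLocus_of_pairwiseFull_boxIsos_plus`, resp. `…_of_fullyFaithful_boxIsos_plus`) is applied DIRECTLY at `𝓔 := quotientPullbackComplex D 𝓓.E`
and the twist-step disappears: this file is that corollary — binders `𝓔`, `h𝓔vb`, `L`, `hL`, `a`, `ha`, `f`, `hf`, `hp` of #3 are DROPPED (`p` is free), the
conclusion is #3's verbatim ((N-U♭) literal). A FOURTH socket: #2 ∕ #3 are untouched and stay as the print-literal siblings; nothing is weakened (this file
FOLLOWS from nothing new and #3 does not follow from it nor conversely — different data). `KunnethFormulaExt` remains the only named fact (inherited).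

* **`oneNonJumpingPoint_of_boxIsos_pairwiseFullPlus`** — pairwise-full `Φ` (as #3);
* **`oneNonJumpingPoint_of_boxIsos_fullyFaithfulPlus`** — `[Φ.Full] [Φ.Faithful]` twin (as #2).

COSTUME (verbatim R19.5 ∕ R19.11 ∕ R19.108): (N-U♭)'s BODY FROM INPUTS over `D⁺`; STATUS-only; no stub is stated, restated or weakened; nothing touches `closes`,
the skeleton or any stub. NOTHING here says (N-U♭), (N-U), (S4), (m), (π), the crux, №4, HC_AV, HC_CM or HC holds; HC_CM HELD, by name only; helper lane (width 0).
References: [cite: Markman2025SecantWeil, §9.3 Rem. 9.3.7, Lemma 9.3.5, Lemma 9.3.11] [cite: Mukai1981, Thm. 2.2 and (3.1)] [cite: StacksProject, Tag 0FXZ].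
-/

noncomputable section

-- `TopCat.Presheaf`/`Scheme.Modules` are not reducible (as in Mathlib's `AlgebraicGeometry/Modules/Sheaf.lean`).
set_option backward.isDefEq.respectTransparency false

open CategoryTheory CategoryTheory.Category CategoryTheory.Limits AlgebraicGeometry

namespace Summit.HodgeConjecture.HodgeConjecture.Ring2.SemiregularRepresentatives

set_option linter.dupNamespace false -- the cell's namespace repeats the summit name, as in every `Ring2*` file

namespace NowhereDisplaceable

open Literature.AlgebraicGeometry Literature.AlgebraicGeometry.Motives Literature.AlgebraicGeometry.Motives.AbelianVariety
open Literature.AlgebraicGeometry.Modules Literature.AlgebraicGeometry.HodgeTheory Literature.AlgebraicGeometry.KTheory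
open Summit.HodgeConjecture.HodgeConjecture.Ring2.SemiregularRepresentatives.MoverTrap

/-- **SOCKET v2 (#4), pairwise-full form: the literal (N-U♭) packaging over `D⁺` with the Φ-STEP applied at `𝓔 := q^*𝓓.E` itself**,
`KunnethFormulaExt` the ONLY named fact: from an (O₁)-datum `(γ, 𝓓)` at `(D, θ₀)`, ANY point `p ∈ P(ℂ)`, resolutions `Rᵢ•`, `Sᵢ•` on `A`, `B` with (vi)
`Ext^{≥0}_B(H₁, H₂) = 0`, a shift-commuting `Φ : D⁺(Mod_{A×B}) ⥤ D⁺(Mod_P)` surjective on `Hom(X₁, X₂⟦k⟧)` for the two box objects, and the two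
isomorphisms `ι(Φ X₁) ≅ Q(t_p^* q^*𝓓.E)`, `ι(Φ X₂) ≅ Q(q^*𝓓.E)` in `D(Mod_P)`: `∃ γ ∈ served, ∃ 𝓓, ∃ p, p ∉ J(q^*𝓓.E)`.
[cite: Markman2025SecantWeil, §9.3 Lemma 9.3.11 and Rem. 9.3.7] [cite: Mukai1981, Thm. 2.2 and (3.1)] [cite: StacksProject, Tag 0FXZ] -/
theorem oneNonJumpingPoint_of_boxIsos_pairwiseFullPlus (hK : KunnethFormulaExt) (C : ChernCharacterBetti)
    (D : SecantQuotientDatum) (θ₀ : complexBetti D.𝒥.J.X 2) {γ : complexBetti D.Y.X (2 * 3)} (hγ : γ ∈ secantQuotientServedClassesPinned D.Y.X (D.hY θ₀))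
    (𝓓 : PinnedTwistedDatum C AdmTw' D.Y.X (D.hY θ₀) γ) (p : D.P.Points ℂ) (A B : AbelianVariety ℂ)
    {G₁ G₂ : A.X.left.Modules} (R₁ : StrictlyPerfectResolution G₁) (R₂ : StrictlyPerfectResolution G₂)
    {H₁ H₂ : B.X.left.Modules} (S₁ : StrictlyPerfectResolution H₁) (S₂ : StrictlyPerfectResolution H₂)
    (hvi : ∀ j : ℕ, letI := HasDerivedCategory.standard B.X.left.Modules
      Subsingleton (ShiftedHom (DerivedCategory.Q.obj ((CochainComplex.singleFunctor B.X.left.Modules 0).obj H₁))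
        (DerivedCategory.Q.obj ((CochainComplex.singleFunctor B.X.left.Modules 0).obj H₂)) (j : ℤ))) :
    letI := HasDerivedCategory.standard (A.prod B).X.left.Modules
    letI := HasDerivedCategory.standard D.P.X.left.Modules
    ∀ (Φ : DerivedCategory.Plus (A.prod B).X.left.Modules ⥤ DerivedCategory.Plus D.P.X.left.Modules) [Φ.CommShift ℤ]
      (_ : ∀ k : ℤ, Function.Surjective (Φ.map :
        ((⟨DerivedCategory.Q.obj (A.boxTensorComplex B R₁.P S₁.P), plus_Q_boxTensorComplex A B R₁ S₁⟩ : DerivedCategory.Plus (A.prod B).X.left.Modules) ⟶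
          (⟨DerivedCategory.Q.obj (A.boxTensorComplex B R₂.P S₂.P), plus_Q_boxTensorComplex A B R₂ S₂⟩ : DerivedCategory.Plus (A.prod B).X.left.Modules)⟦k⟧) → _))
      (_ : DerivedCategory.Plus.ι.obj (Φ.obj ⟨DerivedCategory.Q.obj (A.boxTensorComplex B R₁.P S₁.P), plus_Q_boxTensorComplex A B R₁ S₁⟩) ≅
        DerivedCategory.Q.obj (translationPullbackComplex D.P p (quotientPullbackComplex D 𝓓.E)))
      (_ : DerivedCategory.Plus.ι.obj (Φ.obj ⟨DerivedCategory.Q.obj (A.boxTensorComplex B R₂.P S₂.P), plus_Q_boxTensorComplex A B R₂ S₂⟩) ≅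
        DerivedCategory.Q.obj (quotientPullbackComplex D 𝓓.E)),
      ∃ γ ∈ secantQuotientServedClassesPinned D.Y.X (D.hY θ₀), ∃ 𝓓 : PinnedTwistedDatum C AdmTw' D.Y.X (D.hY θ₀) γ, ∃ p : D.P.Points ℂ,
        p ∉ extJumpLocus D.P (quotientPullbackComplex D 𝓓.E) := by
  intro Φ _ hΦ e₁ e₂
  exact ⟨γ, hγ, 𝓓, p, not_mem_extJumpLocus_of_pairwiseFull_boxIsos_plus hK A B D.P (quotientPullbackComplex D 𝓓.E) p R₁ R₂ S₁ S₂
    hvi Φ hΦ e₁ e₂⟩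

/-- **SOCKET v2 (#4), fully-faithful form**: the same with `[Φ.Full] [Φ.Faithful]` in place of pairwise surjectivity (the Φ-STEP of socket #2,
`not_mem_extJumpLocus_of_fullyFaithful_boxIsos_plus`, at `𝓔 := q^*𝓓.E`). [cite: Markman2025SecantWeil, §9.3 Lemma 9.3.11 and Rem. 9.3.7]
[cite: Mukai1981, Thm. 2.2 and (3.1)] [cite: StacksProject, Tag 0FXZ] -/
theorem oneNonJumpingPoint_of_boxIsos_fullyFaithfulPlus (hK : KunnethFormulaExt) (C : ChernCharacterBetti)
    (D : SecantQuotientDatum) (θ₀ : complexBetti D.𝒥.J.X 2) {γ : complexBetti D.Y.X (2 * 3)} (hγ : γ ∈ secantQuotientServedClassesPinned D.Y.X (D.hY θ₀))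
    (𝓓 : PinnedTwistedDatum C AdmTw' D.Y.X (D.hY θ₀) γ) (p : D.P.Points ℂ) (A B : AbelianVariety ℂ)
    {G₁ G₂ : A.X.left.Modules} (R₁ : StrictlyPerfectResolution G₁) (R₂ : StrictlyPerfectResolution G₂)
    {H₁ H₂ : B.X.left.Modules} (S₁ : StrictlyPerfectResolution H₁) (S₂ : StrictlyPerfectResolution H₂)
    (hvi : ∀ j : ℕ, letI := HasDerivedCategory.standard B.X.left.Modules
      Subsingleton (ShiftedHom (DerivedCategory.Q.obj ((CochainComplex.singleFunctor B.X.left.Modules 0).obj H₁))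
        (DerivedCategory.Q.obj ((CochainComplex.singleFunctor B.X.left.Modules 0).obj H₂)) (j : ℤ))) :
    letI := HasDerivedCategory.standard (A.prod B).X.left.Modules
    letI := HasDerivedCategory.standard D.P.X.left.Modules
    ∀ (Φ : DerivedCategory.Plus (A.prod B).X.left.Modules ⥤ DerivedCategory.Plus D.P.X.left.Modules) [Φ.CommShift ℤ] [Φ.Full] [Φ.Faithful]
      (_ : DerivedCategory.Plus.ι.obj (Φ.obj ⟨DerivedCategory.Q.obj (A.boxTensorComplex B R₁.P S₁.P), plus_Q_boxTensorComplex A B R₁ S₁⟩) ≅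
        DerivedCategory.Q.obj (translationPullbackComplex D.P p (quotientPullbackComplex D 𝓓.E)))
      (_ : DerivedCategory.Plus.ι.obj (Φ.obj ⟨DerivedCategory.Q.obj (A.boxTensorComplex B R₂.P S₂.P), plus_Q_boxTensorComplex A B R₂ S₂⟩) ≅
        DerivedCategory.Q.obj (quotientPullbackComplex D 𝓓.E)),
      ∃ γ ∈ secantQuotientServedClassesPinned D.Y.X (D.hY θ₀), ∃ 𝓓 : PinnedTwistedDatum C AdmTw' D.Y.X (D.hY θ₀) γ, ∃ p : D.P.Points ℂ,
        p ∉ extJumpLocus D.P (quotientPullbackComplex D 𝓓.E) := by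
  intro Φ _ _ _ e₁ e₂
  exact ⟨γ, hγ, 𝓓, p, not_mem_extJumpLocus_of_fullyFaithful_boxIsos_plus hK A B D.P (quotientPullbackComplex D 𝓓.E) p R₁ R₂ S₁ S₂
    hvi Φ e₁ e₂⟩

end NowhereDisplaceable

end Summit.HodgeConjecture.HodgeConjecture.Ring2.SemiregularRepresentatives

end
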